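import Summits.CriticalPhenomena.PercolationContinuityZ3.Theorems.SahiMasterFamilyOrShapeZero
import Summits.CriticalPhenomena.PercolationContinuityZ3.Theorems.SahiMasterFamilyOrShapeLabels
import Summits.CriticalPhenomena.PercolationContinuityZ3.Theorems.SahiMasterFamilyPointwisePinningSettled

/-!
# The OR-shape at every order, VI: the SETTLED class is closed under "OR `{e∈ω}` into all members but one"

Unit `prim-master-conj` (crux anchor stmt-CriticalPhenomena-4575, helper work), gen 17; memo
`run/shared/lean/prim/prim-l12/prim-master-conj/POINTWISE.md` §18.  The disjunctive counterpart of gen 16's conjunctive pinning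
(`Pinning.sahiE_ind_pin_settled`); order 3: gen 15's `Pointwise.sahiE_three_unionCoord_two_free_settled`.

Let `U = (A, B_0 ∪ S_e, …, B_n ∪ S_e)` with `A` increasing (depending on `e` arbitrarily) and `B_j` increasing `e`-free, `p` interior.  The identity
of Part III, `E_p(U) = M_p + t·ν_A·Z_p + R_p`, has three nonnegative pieces whose zero sets are PARAMETER-FREE: the merged functionals (settled by
hypothesis), `ν_A = 0` (transfer, gen 15), `Z = 0 ↔ all B_j sure` and `R = 0 ↔ no point of A⁰ misses two B_j` (Part V-b).  Hence a zero of `E(U)`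
at ONE interior parameter is a zero on the open cube, and (EQI) gives `U ∈ Z_{n+2}`:

* `sahiE_orShape_settled_of_transfer` — core form (hypotheses: merged functionals `≥ 0` at every interior parameter, and zero transfer for them);
* `sahiE_orShape_settled` — if every merged family (block form) is SETTLED then so is `U`;
* `sahiE_orShape_settled_of_labels` — the same with merged families given by surjective labellings `c : Fin (n+1) → Fin r`:
  **if every `(A⁰, (⋂_{j : c j = i} B_j)_{i<r})` is settled then `E_{n+2}(μ_p;1_U) ≥ 0` and `E_{n+2}(μ_p;1_U) = 0 ↔ U ∈ Z_{n+2}`, every order.**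
HONEST FRAMING: a closure statement; `C_k` / `MasterFamilyEqIff k` remain open in general.  Axioms standard. [this work]
-/

set_option autoImplicit false

open Finset

noncomputable section

open scoped Classical

namespace Summit.CriticalPhenomena.PercolationContinuityZ3.Theorems

namespace OrShape

open Function
open Literature.Combinatorics.Sahi2008
open Literature.Combinatorics.Sahi2008.SqFree
open Literature.Probability.Percolation.DecisionTree (ind ind_of_mem ind_of_not_mem ind_nonneg)

section Settled

variable {ι : Type} [Fintype ι] {p : ι → unitInterval} (hp : ∀ i, (p i : ℝ) ∈ Set.Ioo (0 : ℝ) 1) (e : ι) {n : ℕ}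
  {A : Set (Set ι)} (hA : IsUpperSet A) {B : Fin (n + 1) → Set (Set ι)} (hBinc : ∀ j, IsUpperSet (B j))
  (hB : ∀ j (b : Bool), secAt e b (B j) = B j)

include hp hA hBinc hB in
/-- **Settledness of the OR-shape family from zero transfer of the merged functionals** (core form). [this work] -/
theorem sahiE_orShape_settled_of_transfer
    (H0 : ∀ T ∈ blockFamilies (univ : Finset (Fin (n + 2))), (⟨{0}, singleton_nonempty 0⟩ : NEFinset (Fin (n + 2))) ∈ T →
      ∀ q : ι → unitInterval, (∀ i, (q i : ℝ) ∈ Set.Ioo (0 : ℝ) 1) →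
        0 ≤ sahiEOn (bernoulliWeight q) T (fun (σ' : NEFinset (Fin (n + 2))) =>
          ind (if σ'.1 = {0} then secAt e false A else if (0 : Fin (n + 2)) ∈ σ'.1 then (∅ : Set (Set ι))
            else ⋂ j ∈ SqFree.pre σ'.1, B j)))
    (Hzt : ∀ T ∈ blockFamilies (univ : Finset (Fin (n + 2))), (⟨{0}, singleton_nonempty 0⟩ : NEFinset (Fin (n + 2))) ∈ T →
      sahiEOn (bernoulliWeight p) T (fun (σ' : NEFinset (Fin (n + 2))) =>
          ind (if σ'.1 = {0} then secAt e false A else if (0 : Fin (n + 2)) ∈ σ'.1 then (∅ : Set (Set ι))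
            else ⋂ j ∈ SqFree.pre σ'.1, B j)) = 0 →
      ∀ q : ι → unitInterval, (∀ i, (q i : ℝ) ∈ Set.Ioo (0 : ℝ) 1) →
        sahiEOn (bernoulliWeight q) T (fun (σ' : NEFinset (Fin (n + 2))) =>
          ind (if σ'.1 = {0} then secAt e false A else if (0 : Fin (n + 2)) ∈ σ'.1 then (∅ : Set (Set ι))
            else ⋂ j ∈ SqFree.pre σ'.1, B j)) = 0) :
    0 ≤ sahiE (bernoulliWeight p) (n + 2) (fun j => ind ((Matrix.vecCons A (fun j => B j ∪ {ω' : Set ι | e ∈ ω'}) : Fin (n + 2) → Set (Set ι)) j)) ∧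
      (sahiE (bernoulliWeight p) (n + 2) (fun j => ind ((Matrix.vecCons A (fun j => B j ∪ {ω' : Set ι | e ∈ ω'}) : Fin (n + 2) → Set (Set ι)) j)) = 0 ↔
        SuppZeroFlag (n + 2) (Matrix.vecCons A (fun j => B j ∪ {ω' : Set ι | e ∈ ω'}) : Fin (n + 2) → Set (Set ι))) := by
  have hUinc : ∀ j, IsUpperSet ((Matrix.vecCons A (fun j => B j ∪ {ω' : Set ι | e ∈ ω'}) : Fin (n + 2) → Set (Set ι)) j) := by
    intro j; refine Fin.cases ?_ (fun j' => ?_) j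
    · simpa using hA
    · simpa using (hBinc j').union (Pointwise.isUpperSet_coordEvent e)
  rw [Pinning.ind_vecCons]
  -- (M) the merged sum: each term is `Ψ_T(s)·(merged functional)` or `0`
  have hterm : ∀ (q : ι → unitInterval), ∀ T ∈ blockFamilies (univ : Finset (Fin (n + 2))),
      sahiEOn (bernoulliWeight (update q e 0)) T (fun (σ' : NEFinset (Fin (n + 2))) (ω : Set ι) =>
          (if σ'.1 = {0} then (1 : ℝ) else if (0 : Fin (n + 2)) ∈ σ'.1 then 0
            else (-1 : ℝ) ^ (σ'.1.card + 1) * rch σ'.1.card (1 - (q e : ℝ)) * (σ'.1.card.factorial : ℝ)) *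
          ind (if σ'.1 = {0} then secAt e false A else if (0 : Fin (n + 2)) ∈ σ'.1 then (∅ : Set (Set ι))
            else ⋂ j ∈ SqFree.pre σ'.1, B j) ω) =
        if (⟨{0}, singleton_nonempty 0⟩ : NEFinset (Fin (n + 2))) ∈ T then
          (∏ σ' ∈ T.erase ⟨{0}, singleton_nonempty 0⟩, (-1 : ℝ) ^ (σ'.1.card + 1) * rch σ'.1.card (1 - (q e : ℝ)) * (σ'.1.card.factorial : ℝ)) *
            sahiEOn (bernoulliWeight q) T (fun (σ' : NEFinset (Fin (n + 2))) =>
              ind (if σ'.1 = {0} then secAt e false A else if (0 : Fin (n + 2)) ∈ σ'.1 then (∅ : Set (Set ι))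
                else ⋂ j ∈ SqFree.pre σ'.1, B j))
        else 0 := by
    intro q T hT
    by_cases h0 : (⟨{0}, singleton_nonempty 0⟩ : NEFinset (Fin (n + 2))) ∈ T
    · rw [if_pos h0, sahiEOn_merged_eq_smul e A B _ _ h0, sahiEOn_merged_update_eq q e A B hB 0 T]
    · rw [if_neg h0, sahiEOn_merged_eq_zero e A B _ _ hT h0]
  have hpsi_pos : ∀ (q : ι → unitInterval), (∀ i, (q i : ℝ) ∈ Set.Ioo (0 : ℝ) 1) → ∀ T : Finset (NEFinset (Fin (n + 2))),
      0 < ∏ σ' ∈ T.erase ⟨{0}, singleton_nonempty 0⟩, (-1 : ℝ) ^ (σ'.1.card + 1) * rch σ'.1.card (1 - (q e : ℝ)) * (σ'.1.card.factorial : ℝ) :=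
    fun q hq T => Finset.prod_pos fun σ' _ => psi_pos (sub_pos.mpr (hq e).2) (sub_lt_self 1 (hq e).1) (Finset.card_pos.mpr σ'.2)
  have hterm_nonneg : ∀ (q : ι → unitInterval), (∀ i, (q i : ℝ) ∈ Set.Ioo (0 : ℝ) 1) → ∀ T ∈ blockFamilies (univ : Finset (Fin (n + 2))),
      0 ≤ sahiEOn (bernoulliWeight (update q e 0)) T (fun (σ' : NEFinset (Fin (n + 2))) (ω : Set ι) =>
          (if σ'.1 = {0} then (1 : ℝ) else if (0 : Fin (n + 2)) ∈ σ'.1 then 0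
            else (-1 : ℝ) ^ (σ'.1.card + 1) * rch σ'.1.card (1 - (q e : ℝ)) * (σ'.1.card.factorial : ℝ)) *
          ind (if σ'.1 = {0} then secAt e false A else if (0 : Fin (n + 2)) ∈ σ'.1 then (∅ : Set (Set ι))
            else ⋂ j ∈ SqFree.pre σ'.1, B j) ω) := by
    intro q hq T hT
    rw [hterm q T hT]
    split_ifs with h0
    · exact mul_nonneg (hpsi_pos q hq T).le (H0 T hT h0 q hq)
    · exact le_rfl
  -- (N), (R) nonnegativity
  have hZ_nonneg : ∀ q : ι → unitInterval, 0 ≤ (∏ ω, binomB (-((1 - (q e : ℝ)) * bernoulliWeight (update q e 0) ω))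
      (((∑ j : Fin (n + 1), single ({j} : Finset (Fin (n + 1))) (1 : ℝ)) - lin (fun j => ind (B j)) ω) *
        inv1 (lin (fun j => ind (B j)) ω))).coeff univ :=
    fun q => nonneg_EK q e B (sub_nonneg.mpr (q e).2.2) univ
  have hν_nonneg : ∀ q : ι → unitInterval, 0 ≤ ex (bernoulliWeight q) (ind (secAt e true A)) - ex (bernoulliWeight q) (ind (secAt e false A)) :=
    fun q => Pointwise.ex_secAt_true_sub_false_nonneg q e hA
  have hR_nonneg : ∀ q : ι → unitInterval, 0 ≤ ((∏ ω, binomB (-((1 - (q e : ℝ)) * bernoulliWeight (update q e 0) ω))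
          (((∑ j : Fin (n + 1), single ({j} : Finset (Fin (n + 1))) (1 : ℝ)) - lin (fun j => ind (B j)) ω) *
            inv1 (lin (fun j => ind (B j)) ω))) *
        ∑ ω, C (bernoulliWeight (update q e 0) ω * ind (secAt e false A) ω) *
          (1 - C (1 - (q e : ℝ)) * ((((∑ j : Fin (n + 1), single ({j} : Finset (Fin (n + 1))) (1 : ℝ)) - lin (fun j => ind (B j)) ω) *
            inv1 (lin (fun j => ind (B j)) ω))) -
            binomB (1 - (q e : ℝ)) ((((∑ j : Fin (n + 1), single ({j} : Finset (Fin (n + 1))) (1 : ℝ)) - lin (fun j => ind (B j)) ω) *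
            inv1 (lin (fun j => ind (B j)) ω))))).coeff univ := by
    intro q
    refine (nonneg_mul (nonneg_EK q e B (sub_nonneg.mpr (q e).2.2)) (nonneg_sum fun ω _ => nonneg_mul (nonneg_C (mul_nonneg ?_ (ind_nonneg _ _)))
      (nonneg_one_sub_smul_sub_binomB (sub_nonneg.mpr (q e).2.2) (sub_le_self 1 (q e).2.1) (isNil_r B ω) (nonneg_r B ω)))) univ
    exact Literature.Probability.Percolation.BHK2006.weight_nonneg (fun i => (update q e 0 i).2.1) (fun i => (update q e 0 i).2.2) ω
  refine ⟨(sahiE_orShape_dominates p e A B hA hB fun T hT h0 => H0 T hT h0 p hp).2, fun hz => ?_, fun hZ => ?_⟩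
  · -- a zero at `p` is a zero on the open cube
    refine Pointwise.suppZeroFlag_of_eq_zero_on_paramBox _ hUinc (a := fun _ => 0) (b := fun _ => 1) (fun _ => zero_lt_one) (fun _ => le_rfl)
      (fun _ => le_rfl) fun q hq => ?_
    rw [Pinning.ind_vecCons]
    -- decompose the zero at `p`
    have hIdp := sahiE_orShape_eq_merged_add p e A B
    rw [hz] at hIdp
    have hMp := Finset.sum_nonneg (hterm_nonneg p hp)
    have hNp := mul_nonneg (mul_nonneg (p e).2.1 (hν_nonneg p)) (hZ_nonneg p)
    have hRp := hR_nonneg p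
    have hM0 : ∑ T ∈ blockFamilies (univ : Finset (Fin (n + 2))),
        sahiEOn (bernoulliWeight (update p e 0)) T (fun (σ' : NEFinset (Fin (n + 2))) (ω : Set ι) =>
          (if σ'.1 = {0} then (1 : ℝ) else if (0 : Fin (n + 2)) ∈ σ'.1 then 0
            else (-1 : ℝ) ^ (σ'.1.card + 1) * rch σ'.1.card (1 - (p e : ℝ)) * (σ'.1.card.factorial : ℝ)) *
          ind (if σ'.1 = {0} then secAt e false A else if (0 : Fin (n + 2)) ∈ σ'.1 then (∅ : Set (Set ι))
            else ⋂ j ∈ SqFree.pre σ'.1, B j) ω) = 0 := by linarith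
    have hN0 : (p e : ℝ) * (ex (bernoulliWeight p) (ind (secAt e true A)) - ex (bernoulliWeight p) (ind (secAt e false A))) *
        (∏ ω, binomB (-((1 - (p e : ℝ)) * bernoulliWeight (update p e 0) ω))
          (((∑ j : Fin (n + 1), single ({j} : Finset (Fin (n + 1))) (1 : ℝ)) - lin (fun j => ind (B j)) ω) *
            inv1 (lin (fun j => ind (B j)) ω))).coeff univ = 0 := by linarith
    have hR0 : ((∏ ω, binomB (-((1 - (p e : ℝ)) * bernoulliWeight (update p e 0) ω))
          (((∑ j : Fin (n + 1), single ({j} : Finset (Fin (n + 1))) (1 : ℝ)) - lin (fun j => ind (B j)) ω) *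
            inv1 (lin (fun j => ind (B j)) ω))) *
        ∑ ω, C (bernoulliWeight (update p e 0) ω * ind (secAt e false A) ω) *
          (1 - C (1 - (p e : ℝ)) * ((((∑ j : Fin (n + 1), single ({j} : Finset (Fin (n + 1))) (1 : ℝ)) - lin (fun j => ind (B j)) ω) *
            inv1 (lin (fun j => ind (B j)) ω))) -
            binomB (1 - (p e : ℝ)) ((((∑ j : Fin (n + 1), single ({j} : Finset (Fin (n + 1))) (1 : ℝ)) - lin (fun j => ind (B j)) ω) *
            inv1 (lin (fun j => ind (B j)) ω))))).coeff univ = 0 := by linarith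
    -- the identity at `q`
    rw [sahiE_orShape_eq_merged_add q e A B]
    -- (M) every term transfers
    have hMq : ∑ T ∈ blockFamilies (univ : Finset (Fin (n + 2))),
        sahiEOn (bernoulliWeight (update q e 0)) T (fun (σ' : NEFinset (Fin (n + 2))) (ω : Set ι) =>
          (if σ'.1 = {0} then (1 : ℝ) else if (0 : Fin (n + 2)) ∈ σ'.1 then 0
            else (-1 : ℝ) ^ (σ'.1.card + 1) * rch σ'.1.card (1 - (q e : ℝ)) * (σ'.1.card.factorial : ℝ)) *
          ind (if σ'.1 = {0} then secAt e false A else if (0 : Fin (n + 2)) ∈ σ'.1 then (∅ : Set (Set ι))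
            else ⋂ j ∈ SqFree.pre σ'.1, B j) ω) = 0 := by
      have hterm0 := (Finset.sum_eq_zero_iff_of_nonneg (hterm_nonneg p hp)).1 hM0
      refine Finset.sum_eq_zero fun T hT => ?_
      rw [hterm q T hT]
      split_ifs with h0
      · have ht := hterm0 T hT
        rw [hterm p T hT, if_pos h0] at ht
        have hzero := (mul_eq_zero.mp ht).resolve_left (ne_of_gt (hpsi_pos p hp T))
        rw [Hzt T hT h0 hzero q hq, mul_zero]
      · rfl
    -- (R) transfers through the parameter-free criterion
    have hRq := (rc_eq_zero_iff q e A B hq).2 ((rc_eq_zero_iff p e A B hp).1 hR0)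
    -- (N) either `ν_A = 0` (transfers) or `Z = 0` (all `B_j` sure, transfers)
    have hNq : (q e : ℝ) * (ex (bernoulliWeight q) (ind (secAt e true A)) - ex (bernoulliWeight q) (ind (secAt e false A))) *
        (∏ ω, binomB (-((1 - (q e : ℝ)) * bernoulliWeight (update q e 0) ω))
          (((∑ j : Fin (n + 1), single ({j} : Finset (Fin (n + 1))) (1 : ℝ)) - lin (fun j => ind (B j)) ω) *
            inv1 (lin (fun j => ind (B j)) ω))).coeff univ = 0 := by
      by_cases hν : ex (bernoulliWeight p) (ind (secAt e true A)) - ex (bernoulliWeight p) (ind (secAt e false A)) = 0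
      · rw [Pointwise.ex_secAt_sub_eq_zero_transfer hp q e hA hν, mul_zero, zero_mul]
      · have htp : (p e : ℝ) ≠ 0 := ne_of_gt (hp e).1
        have hZp := (mul_eq_zero.mp hN0).resolve_left (mul_ne_zero htp hν)
        have hBu := (coeff_univ_EK_eq_zero_iff p e B hp hB).1 hZp
        rw [(coeff_univ_EK_eq_zero_iff q e B hq hB).2 hBu, mul_zero]
    rw [hMq, hRq, hNq]
    ring
  · have h0 := masterFamilyEqIff_mpr _ ι p _ hZ
    rwa [Pinning.ind_vecCons] at h0

include hp hA hBinc hB in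
/-- **THE SETTLED CLASS IS CLOSED UNDER "OR `{e∈ω}` INTO ALL MEMBERS BUT ONE", EVERY ORDER** (block form).  If every merged family of
`(A⁰; B_0,…,B_n)` — realised on the block families `T ∋ {0}` of all slots — is settled on the open cube (`E ≥ 0` and `E = 0 ↔ Z`), then
`U = (A, B_0 ∪ S_e, …, B_n ∪ S_e)` is settled at `p`. [this work] -/
theorem sahiE_orShape_settled
    (Hset : ∀ T ∈ blockFamilies (univ : Finset (Fin (n + 2))), (⟨{0}, singleton_nonempty 0⟩ : NEFinset (Fin (n + 2))) ∈ T →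
      ∀ q : ι → unitInterval, (∀ i, (q i : ℝ) ∈ Set.Ioo (0 : ℝ) 1) →
        0 ≤ sahiEOn (bernoulliWeight q) T (fun (σ' : NEFinset (Fin (n + 2))) =>
          ind (if σ'.1 = {0} then secAt e false A else if (0 : Fin (n + 2)) ∈ σ'.1 then (∅ : Set (Set ι))
            else ⋂ j ∈ SqFree.pre σ'.1, B j)) ∧
        (sahiEOn (bernoulliWeight q) T (fun (σ' : NEFinset (Fin (n + 2))) =>
          ind (if σ'.1 = {0} then secAt e false A else if (0 : Fin (n + 2)) ∈ σ'.1 then (∅ : Set (Set ι))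
            else ⋂ j ∈ SqFree.pre σ'.1, B j)) = 0 ↔
          SuppZeroFlag T.card (fun i : Fin T.card => (if ((T.equivFin.symm i : T) : NEFinset (Fin (n + 2))).1 = {0} then secAt e false A
            else if (0 : Fin (n + 2)) ∈ ((T.equivFin.symm i : T) : NEFinset (Fin (n + 2))).1 then (∅ : Set (Set ι))
            else ⋂ j ∈ SqFree.pre ((T.equivFin.symm i : T) : NEFinset (Fin (n + 2))).1, B j)))) :
    0 ≤ sahiE (bernoulliWeight p) (n + 2) (fun j => ind ((Matrix.vecCons A (fun j => B j ∪ {ω' : Set ι | e ∈ ω'}) : Fin (n + 2) → Set (Set ι)) j)) ∧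
      (sahiE (bernoulliWeight p) (n + 2) (fun j => ind ((Matrix.vecCons A (fun j => B j ∪ {ω' : Set ι | e ∈ ω'}) : Fin (n + 2) → Set (Set ι)) j)) = 0 ↔
        SuppZeroFlag (n + 2) (Matrix.vecCons A (fun j => B j ∪ {ω' : Set ι | e ∈ ω'}) : Fin (n + 2) → Set (Set ι))) :=
  sahiE_orShape_settled_of_transfer hp e hA hBinc hB (fun T hT h0 q hq => (Hset T hT h0 q hq).1)
    fun T hT h0 hz q _ => masterFamilyEqIff_mpr _ ι q _ ((Hset T hT h0 p hp).2.1 hz)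

include hp hA hBinc hB in
/-- **THE SETTLED CLASS IS CLOSED UNDER "OR `{e∈ω}` INTO ALL MEMBERS BUT ONE", EVERY ORDER** (labelling form).  `p` interior, `A` increasing,
`B_0,…,B_n` increasing `e`-free.  If for every surjective labelling `c : Fin (n+1) → Fin r` the merged family `(A⁰, (⋂_{j : c j = i} B_j)_{i<r})` is
settled on the open cube (`E_{r+1}(μ_q;·) ≥ 0` and `= 0 ↔ Z_{r+1}` for every interior `q`), then `U = (A, B_0 ∪ S_e, …, B_n ∪ S_e)` is settled at `p`:
`E_{n+2}(μ_p; 1_U) ≥ 0` and `E_{n+2}(μ_p; 1_U) = 0 ↔ U ∈ Z_{n+2}`. [this work] -/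
theorem sahiE_orShape_settled_of_labels
    (HsetL : ∀ (r : ℕ) (c : Fin (n + 1) → Fin r), Function.Surjective c →
      ∀ q : ι → unitInterval, (∀ i, (q i : ℝ) ∈ Set.Ioo (0 : ℝ) 1) →
        0 ≤ sahiE (bernoulliWeight q) (r + 1) (Matrix.vecCons (ind (secAt e false A))
          (fun i => ind (⋂ j ∈ (univ : Finset (Fin (n + 1))).filter (fun j => c j = i), B j))) ∧
        (sahiE (bernoulliWeight q) (r + 1) (Matrix.vecCons (ind (secAt e false A))
          (fun i => ind (⋂ j ∈ (univ : Finset (Fin (n + 1))).filter (fun j => c j = i), B j))) = 0 ↔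
          SuppZeroFlag (r + 1) (Matrix.vecCons (secAt e false A)
            (fun i => ⋂ j ∈ (univ : Finset (Fin (n + 1))).filter (fun j => c j = i), B j) : Fin (r + 1) → Set (Set ι)))) :
    0 ≤ sahiE (bernoulliWeight p) (n + 2) (fun j => ind ((Matrix.vecCons A (fun j => B j ∪ {ω' : Set ι | e ∈ ω'}) : Fin (n + 2) → Set (Set ι)) j)) ∧
      (sahiE (bernoulliWeight p) (n + 2) (fun j => ind ((Matrix.vecCons A (fun j => B j ∪ {ω' : Set ι | e ∈ ω'}) : Fin (n + 2) → Set (Set ι)) j)) = 0 ↔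
        SuppZeroFlag (n + 2) (Matrix.vecCons A (fun j => B j ∪ {ω' : Set ι | e ∈ ω'}) : Fin (n + 2) → Set (Set ι))) := by
  refine sahiE_orShape_settled_of_transfer hp e hA hBinc hB (fun T hT h0 q hq => ?_) (fun T hT h0 hz q hq => ?_)
  · obtain ⟨r, c, hc, h⟩ := exists_labels_eq e A B T hT h0
    rw [h]
    exact (HsetL r c hc q hq).1
  · obtain ⟨r, c, hc, h⟩ := exists_labels_eq e A B T hT h0
    rw [h] at hz ⊢
    have hZ := (HsetL r c hc p hp).2.1 hz
    have h0' := masterFamilyEqIff_mpr _ ι q _ hZ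
    rwa [Pinning.ind_vecCons] at h0'

end Settled

end OrShape
end Summit.CriticalPhenomena.PercolationContinuityZ3.Theorems
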